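import Literature.AlgebraicGeometry.Motives.SeesawSemicontinuity
import Mathlib.AlgebraicGeometry.Morphisms.Flat
import Mathlib.Algebra.Category.Ring.Constructions
import Mathlib.RingTheory.IsTensorProduct
import HarnessLib

/-!
# Sections over the fibre `X_t` of `X ×_K T → T`: affine base change (Görtz–Wedhorn II, proof of Thm. 22.90)

For `X → Spec K` and a `K`-scheme `T`, the fibre `X_t = X ×_K Spec κ(t)` of `pr_T : X ×_K T → T`
over `t ∈ T` (`Motives/SeesawTheorem`: the integral scheme `X ⊗ residuePt T t` with its morphism
`X ◁ residuePtι T t : X_t → X ×_K T`) sits in the cartesian square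

  `X_t ——→ X ×_K T`
  ` ↓            ↓ pr_T`
  `Spec κ(t) —→ T`

(`isPullback_fibre`, pasting of the defining squares). For an affine open `V ∋ t` of `T` and an
affine open `W ⊆ pr_T⁻¹V`, **affine base change of sections** gives
`κ(t) ⊗_{Γ(V, 𝒪_T)} Γ(W, 𝒪_{X ×_K T}) ⥲ Γ(W_t, 𝒪_{X_t})`, `W_t` the preimage of `W` in `X_t`
(`fibreSectionsEquiv`, a `κ(t)`-algebra isomorphism; Görtz–Wedhorn II, proof of Thm. 22.90,
p. 388: "`𝓕(V) ⊗_A A' = 𝓕(u'⁻¹(V), 𝓕')` for every open affine subscheme `V ⊆ X`", here for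
`𝓕 = 𝒪` and the base change `Spec κ(t) → V`; Mathlib `isIso_pushoutSection_of_isAffineOpen`),
with `Γ(V, 𝒪_T)` acting on `κ(t)` by *evaluation* (Mathlib `Scheme.evaluation`, the structure
used in `Motives/SemicontinuityGrothendieckComplex`; `evaluation_eq_appLE_ΓSpecIso` identifies it
with `Γ(V, 𝒪_T) → Γ(Spec κ(t), 𝒪) ≅ κ(t)`), and `κ(t)` acting on `Γ(W_t, 𝒪_{X_t})` through
`κ(t) ≅ Γ(Spec κ(t), 𝒪) → Γ(W_t, 𝒪_{X_t})` (`fibreSecAlgebra`). On pure tensors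
`c ⊗ r ↦ c · r|_{W_t}` (`fibreSectionsEquiv_tmul`).

This is the base-change input of the identification `Ker(d⁰_Č ⊗ κ(t)) ≅ H⁰(X_t, 𝒪(D_t))` for the
Čech complex of `𝒪(D)` (`Motives/GrothendieckComplexCech`, named fact `cechComplex_h0_fibre`).
Everything is proved. Mathlib searched (pin): `isIso_pushoutSection_of_isAffineOpen`,
`isIso_pushoutSection_iff`, `CommRingCat.isPushout_iff_isPushout`, `Algebra.IsPushout.equiv`,
`IsPushout.of_iso`, `IsPullback.of_right`, `Scheme.germ_stalkClosedPointTo`,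
`Scheme.germ_stalkClosedPointTo_Spec_fromSpecStalk`, `Over.whiskerLeft_left_fst/snd` (used).

## References

* U. Görtz, T. Wedhorn, *Algebraic Geometry II: Cohomology of Schemes*, Springer Spektrum (2023),
  doi:10.1007/978-3-658-43031-3: proof of Thm. 22.90 and Cor. 22.91, p. 388; (23.28.5), p. 482.
  [GortzWedhorn2023]
* U. Görtz, T. Wedhorn, *Algebraic Geometry I: Schemes*, 2nd ed. (2020): Prop. 4.16/4.20
  (transitivity of fibre products, fibres), pp. 101–105. [GortzWedhorn2020]
-/

universe u

open CategoryTheory CategoryTheory.Limits AlgebraicGeometry MonoidalCategory TopologicalSpace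
open CartesianMonoidalCategory TensorProduct
open Literature.AlgebraicGeometry.Motives.RatFn

noncomputable section

namespace Literature.AlgebraicGeometry.Motives

variable {K : Type u} [Field K] (X T : SchemeOver K) (t : T.left)

/-! ### The fibre square -/

/-- The inclusion `X_t → X ×_K T` of the fibre over `t` (underlying morphism of
`X ◁ residuePtι T t`). [folklore] -/
abbrev fibreι : (X ⊗ residuePt T t).left ⟶ (X ⊗ T).left := (X ◁ residuePtι T t).left

/-- The structure morphism `X_t → Spec κ(t)` (that of `fibreOverResidueField`). [folklore] -/
abbrev fibreStr : (X ⊗ residuePt T t).left ⟶ Spec (T.left.residueField t) :=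
  pullback.snd X.hom (residuePt T t).hom

/-- **The fibre square is cartesian**: `X_t = (X ×_K T) ×_T Spec κ(t)`, i.e. the square
`X_t → X ×_K T → T ← Spec κ(t) ← X_t` is a pullback (pasting the defining pullback squares of
`X ×_K Spec κ(t)` and `X ×_K T` over `Spec K`; Görtz–Wedhorn I, Prop. 4.16). [folklore] -/
theorem isPullback_fibre :
    IsPullback (fibreι X T t) (fibreStr X T t) (snd X T).left (T.left.fromSpecResidueField t) := by
  have big : IsPullback (fibreι X T t ≫ pullback.fst X.hom T.hom) (fibreStr X T t) X.hom
      ((residuePtι T t).left ≫ T.hom) := by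
    rw [Over.whiskerLeft_left_fst]
    exact IsPullback.of_hasPullback X.hom (residuePt T t).hom
  exact IsPullback.of_right big (Over.whiskerLeft_left_snd (residuePtι T t))
    (IsPullback.of_hasPullback X.hom T.hom)

variable {T t} in
/-- `Spec κ(t) → T` maps into every open containing `t`. [folklore] -/
theorem top_le_preimage_fromSpecResidueField {V : T.left.Opens} (ht : t ∈ V) :
    (⊤ : (Spec (T.left.residueField t)).Opens) ≤ T.left.fromSpecResidueField t ⁻¹ᵁ V :=
  fun s _ => by
    change T.left.fromSpecResidueField t s ∈ V
    rw [Scheme.fromSpecResidueField_apply]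
    exact ht

variable {T t} in
/-- **Evaluation at `t` is `Γ(V, 𝒪_T) → Γ(Spec κ(t), 𝒪) ≅ κ(t)`**: Mathlib's `Scheme.evaluation`
(germ followed by the residue map) agrees with pulling back sections along `Spec κ(t) → T` and
identifying `Γ(Spec κ(t), 𝒪) = κ(t)`. [folklore] -/
theorem evaluation_eq_appLE_ΓSpecIso {V : T.left.Opens} (ht : t ∈ V) :
    (T.left.fromSpecResidueField t).appLE V ⊤ (top_le_preimage_fromSpecResidueField ht) ≫
        (Scheme.ΓSpecIso (T.left.residueField t)).hom =
      T.left.evaluation V t ht := by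
  set ι := T.left.fromSpecResidueField t with hι
  have hc : ι (IsLocalRing.closedPoint (T.left.residueField t)) ∈ V := by
    rw [hι, Scheme.fromSpecResidueField_apply]; exact ht
  have e : ι ⁻¹ᵁ V = ⊤ := Scheme.preimage_eq_top_of_closedPoint_mem ι hc
  have h1 := Scheme.germ_stalkClosedPointTo ι V hc
  haveI : IsLocalHom (T.left.residue t).hom :=
    inferInstanceAs (IsLocalHom (IsLocalRing.residue (T.left.presheaf.stalk t)))
  have h2 := Scheme.germ_stalkClosedPointTo_Spec_fromSpecStalk (T.left.residue t) V hc
  have h3 : ι.app V ≫ ((Spec (T.left.residueField t)).presheaf.mapIso (eqToIso e.symm).op ≪≫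
      Scheme.ΓSpecIso (T.left.residueField t)).hom = T.left.evaluation V t ht := by
    rw [← h1]
    exact h2
  rw [← h3, Iso.trans_hom, Functor.mapIso_hom, ← Category.assoc]
  -- `appLE V ⊤ = app V ≫ map (⊤ → ι⁻¹V)`, and `Opens` is thin
  congr 1

/-! ### Affine base change of sections to the fibre -/

section AffineBaseChange

variable {X T t}

/-- **The sections over `W_t ⊆ X_t` form the pushout `Γ(W, 𝒪) ⊗_{Γ(V, 𝒪_T)} κ(t)`** for affine
`W ⊆ pr_T⁻¹V`, `V` affine, with `Γ(V, 𝒪_T) → κ(t)` the evaluation map: the square of rings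
`Γ(V, 𝒪_T) → Γ(W, 𝒪_{X ×_K T}) → Γ(W_t, 𝒪_{X_t}) ← κ(t) ← Γ(V, 𝒪_T)` is cocartesian
(Mathlib `isIso_pushoutSection_of_isAffineOpen` for the cartesian fibre square, with
`Γ(Spec κ(t), 𝒪) ≅ κ(t)`; Görtz–Wedhorn II, proof of Thm. 22.90: `𝓕(V) ⊗_A A' = 𝓕(u'⁻¹(V), 𝓕')`).
[cite: GortzWedhorn2023, Thm. 22.90, proof (p. 388)] -/
theorem isPushout_sections_fibre {V : T.left.Opens} (ht : t ∈ V) {W : (X ⊗ T).left.Opens}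
    (hWV : W ≤ (snd X T).left ⁻¹ᵁ V) (hV : IsAffineOpen V) (hW : IsAffineOpen W) :
    IsPushout ((snd X T).left.appLE V W hWV) (T.left.evaluation V t ht)
      ((fibreι X T t).appLE W (fibreι X T t ⁻¹ᵁ W) le_rfl)
      ((Scheme.ΓSpecIso (T.left.residueField t)).inv ≫
        (fibreStr X T t).appLE ⊤ (fibreι X T t ⁻¹ᵁ W) le_top) := by
  have H := isPullback_fibre X T t
  have hUY : fibreι X T t ⁻¹ᵁ W = fibreι X T t ⁻¹ᵁ W ⊓ fibreStr X T t ⁻¹ᵁ ⊤ := by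
    simp only [Scheme.Hom.preimage_top, inf_top_eq]
  have hiso := isIso_pushoutSection_of_isAffineOpen H (US := V) (UT := ⊤) (UX := W)
    (UY := fibreι X T t ⁻¹ᵁ W) (top_le_preimage_fromSpecResidueField ht) hWV hUY hV
    (isAffineOpen_top _) hW
  have hpo := (isIso_pushoutSection_iff H (US := V) (UT := ⊤) (UX := W)
    (UY := fibreι X T t ⁻¹ᵁ W) (top_le_preimage_fromSpecResidueField ht) hWV hUY).mp hiso
  refine hpo.of_iso (Iso.refl _) (Iso.refl _) (Scheme.ΓSpecIso _) (Iso.refl _) (by simp) ?_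
    (by simp) ?_
  · rw [Iso.refl_hom, Category.id_comp]
    exact evaluation_eq_appLE_ΓSpecIso ht
  · rw [Iso.refl_hom, Category.comp_id, Iso.hom_inv_id_assoc]

variable (X T t)

/-- The `κ(t)`-algebra structure on the sections `Γ(W', 𝒪_{X_t})` over an open of the fibre:
`κ(t) ≅ Γ(Spec κ(t), 𝒪) → Γ(X_t, 𝒪) → Γ(W', 𝒪_{X_t})` (an `abbrev`, activated with `letI`; it is
the structure under which `K(X_t)` is a `κ(t)`-algebra in `Motives/CartierDivisor`, restricted
to `W'`). [folklore] -/
abbrev fibreSecAlgebra (W' : (X ⊗ residuePt T t).left.Opens) :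
    Algebra (T.left.residueField t) Γ((X ⊗ residuePt T t).left, W') :=
  ((Scheme.ΓSpecIso (T.left.residueField t)).inv ≫
    (fibreStr X T t).appLE ⊤ W' le_top).hom.toAlgebra

/-- `Γ(V, 𝒪_T)` acting on `κ(t)` by evaluation at `t ∈ V` (Mathlib `Scheme.evaluation`; an
`abbrev`, activated with `letI`). [folklore] -/
abbrev evalAlgebra {V : T.left.Opens} (ht : t ∈ V) : Algebra Γ(T.left, V) (T.left.residueField t) :=
  (T.left.evaluation V t ht).hom.toAlgebra

/-- `Γ(V, 𝒪_T)` acting on `Γ(W, 𝒪_{X ×_K T})` through `pr_T` (`W ⊆ pr_T⁻¹V`; an `abbrev`, equal to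
`CartierDivisor.secAlgebra` of `Motives/CartierDivisorCech`). [folklore] -/
abbrev prSecAlgebra {V : T.left.Opens} {W : (X ⊗ T).left.Opens} (hWV : W ≤ (snd X T).left ⁻¹ᵁ V) :
    Algebra Γ(T.left, V) Γ((X ⊗ T).left, W) :=
  ((snd X T).left.appLE V W hWV).hom.toAlgebra

/-- `Γ(W, 𝒪_{X ×_K T})` acting on `Γ(W_t, 𝒪_{X_t})` by pull-back along the fibre inclusion (an
`abbrev`). [folklore] -/
abbrev fibreιAlgebra (W : (X ⊗ T).left.Opens) :
    Algebra Γ((X ⊗ T).left, W) Γ((X ⊗ residuePt T t).left, fibreι X T t ⁻¹ᵁ W) :=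
  ((fibreι X T t).appLE W (fibreι X T t ⁻¹ᵁ W) le_rfl).hom.toAlgebra

/-- `Γ(V, 𝒪_T)` acting on `Γ(W_t, 𝒪_{X_t})` through `Γ(W, 𝒪)` (an `abbrev`). [folklore] -/
abbrev baseFibreAlgebra {V : T.left.Opens} {W : (X ⊗ T).left.Opens}
    (hWV : W ≤ (snd X T).left ⁻¹ᵁ V) :
    Algebra Γ(T.left, V) Γ((X ⊗ residuePt T t).left, fibreι X T t ⁻¹ᵁ W) :=
  (((fibreι X T t).appLE W (fibreι X T t ⁻¹ᵁ W) le_rfl).hom.comp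
    ((snd X T).left.appLE V W hWV).hom).toAlgebra

variable {X T t}

/-- `Γ(V, 𝒪_T) → Γ(W, 𝒪) → Γ(W_t, 𝒪)` is a scalar tower (by definition). [folklore] -/
theorem isScalarTower_prSec {V : T.left.Opens} {W : (X ⊗ T).left.Opens}
    (hWV : W ≤ (snd X T).left ⁻¹ᵁ V) :
    letI := prSecAlgebra X T hWV
    letI := fibreιAlgebra X T t W
    letI := baseFibreAlgebra X T t hWV
    IsScalarTower Γ(T.left, V) Γ((X ⊗ T).left, W)
      Γ((X ⊗ residuePt T t).left, fibreι X T t ⁻¹ᵁ W) :=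
  letI := prSecAlgebra X T hWV
  letI := fibreιAlgebra X T t W
  letI := baseFibreAlgebra X T t hWV
  IsScalarTower.of_algebraMap_eq fun _ => rfl

set_option backward.isDefEq.respectTransparency false in
/-- `Γ(V, 𝒪_T) → κ(t) → Γ(W_t, 𝒪)` is a scalar tower: pulling back `pr_T^♯(a)|_W` to the fibre
gives the constant `a(t)` (commutativity of the fibre square on sections). [folklore] -/
theorem isScalarTower_eval {V : T.left.Opens} (ht : t ∈ V) {W : (X ⊗ T).left.Opens}
    (hWV : W ≤ (snd X T).left ⁻¹ᵁ V) (hV : IsAffineOpen V) (hW : IsAffineOpen W) :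
    letI := evalAlgebra T t ht
    letI := fibreSecAlgebra X T t (fibreι X T t ⁻¹ᵁ W)
    letI := baseFibreAlgebra X T t hWV
    IsScalarTower Γ(T.left, V) (T.left.residueField t)
      Γ((X ⊗ residuePt T t).left, fibreι X T t ⁻¹ᵁ W) :=
  letI := evalAlgebra T t ht
  letI := fibreSecAlgebra X T t (fibreι X T t ⁻¹ᵁ W)
  letI := baseFibreAlgebra X T t hWV
  IsScalarTower.of_algebraMap_eq fun a => by
    have h := congr_arg (fun φ => φ.hom a) (isPushout_sections_fibre ht hWV hV hW).w
    exact h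

set_option backward.isDefEq.respectTransparency false in
/-- **`Γ(W_t, 𝒪_{X_t}) = κ(t) ⊗_{Γ(V, 𝒪_T)} Γ(W, 𝒪)` as algebras** (`Algebra.IsPushout`), for `W`,
`V` affine: the algebraic form of `isPushout_sections_fibre`. [cite: GortzWedhorn2023, Thm. 22.90, proof (p. 388)] -/
theorem algebraIsPushout_fibre {V : T.left.Opens} (ht : t ∈ V) {W : (X ⊗ T).left.Opens}
    (hWV : W ≤ (snd X T).left ⁻¹ᵁ V) (hV : IsAffineOpen V) (hW : IsAffineOpen W) :
    letI := evalAlgebra T t ht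
    letI := prSecAlgebra X T hWV
    letI := fibreSecAlgebra X T t (fibreι X T t ⁻¹ᵁ W)
    letI := fibreιAlgebra X T t W
    letI := baseFibreAlgebra X T t hWV
    haveI := isScalarTower_prSec (t := t) hWV
    haveI := isScalarTower_eval ht hWV hV hW
    Algebra.IsPushout Γ(T.left, V) (T.left.residueField t) Γ((X ⊗ T).left, W)
      Γ((X ⊗ residuePt T t).left, fibreι X T t ⁻¹ᵁ W) := by
  letI := evalAlgebra T t ht
  letI := prSecAlgebra X T hWV
  letI := fibreSecAlgebra X T t (fibreι X T t ⁻¹ᵁ W)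
  letI := fibreιAlgebra X T t W
  letI := baseFibreAlgebra X T t hWV
  haveI := isScalarTower_prSec (t := t) hWV
  haveI := isScalarTower_eval ht hWV hV hW
  haveI hpo : Algebra.IsPushout Γ(T.left, V) Γ((X ⊗ T).left, W) (T.left.residueField t)
      Γ((X ⊗ residuePt T t).left, fibreι X T t ⁻¹ᵁ W) :=
    CommRingCat.isPushout_iff_isPushout.mp (isPushout_sections_fibre ht hWV hV hW)
  exact hpo.symm

/-- **Affine base change of sections to the fibre, as a `κ(t)`-algebra isomorphism**
`κ(t) ⊗_{Γ(V, 𝒪_T)} Γ(W, 𝒪_{X ×_K T}) ⥲ Γ(W_t, 𝒪_{X_t})` (`W ⊆ pr_T⁻¹V` affine, `V ∋ t` affine;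
`Γ(V, 𝒪_T)` acts on `κ(t)` by evaluation and on `Γ(W, 𝒪)` through `pr_T`; Görtz–Wedhorn II,
proof of Thm. 22.90, p. 388). [cite: GortzWedhorn2023, Thm. 22.90, proof (p. 388)] -/
def fibreSectionsEquiv {V : T.left.Opens} (ht : t ∈ V) {W : (X ⊗ T).left.Opens}
    (hWV : W ≤ (snd X T).left ⁻¹ᵁ V) (hV : IsAffineOpen V) (hW : IsAffineOpen W) :
    letI := evalAlgebra T t ht
    letI := prSecAlgebra X T hWV
    letI := fibreSecAlgebra X T t (fibreι X T t ⁻¹ᵁ W)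
    T.left.residueField t ⊗[Γ(T.left, V)] Γ((X ⊗ T).left, W) ≃ₐ[T.left.residueField t]
      Γ((X ⊗ residuePt T t).left, fibreι X T t ⁻¹ᵁ W) :=
  letI := evalAlgebra T t ht
  letI := prSecAlgebra X T hWV
  letI := fibreSecAlgebra X T t (fibreι X T t ⁻¹ᵁ W)
  letI := fibreιAlgebra X T t W
  letI := baseFibreAlgebra X T t hWV
  haveI := isScalarTower_prSec (t := t) hWV
  haveI := isScalarTower_eval ht hWV hV hW
  haveI : Algebra.IsPushout Γ(T.left, V) (T.left.residueField t) Γ((X ⊗ T).left, W)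
      Γ((X ⊗ residuePt T t).left, fibreι X T t ⁻¹ᵁ W) := algebraIsPushout_fibre ht hWV hV hW
  Algebra.IsPushout.equiv Γ(T.left, V) (T.left.residueField t) Γ((X ⊗ T).left, W)
    Γ((X ⊗ residuePt T t).left, fibreι X T t ⁻¹ᵁ W)

/-- **The base change isomorphism on pure tensors**: `c ⊗ r ↦ c · (r|_{W_t})`, i.e. the constant
`c ∈ κ(t)` times the pull-back of `r ∈ Γ(W, 𝒪)` to `W_t ⊆ X_t`. [folklore] -/
theorem fibreSectionsEquiv_tmul {V : T.left.Opens} (ht : t ∈ V) {W : (X ⊗ T).left.Opens}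
    (hWV : W ≤ (snd X T).left ⁻¹ᵁ V) (hV : IsAffineOpen V) (hW : IsAffineOpen W)
    (c : T.left.residueField t) (r : Γ((X ⊗ T).left, W)) :
    letI := evalAlgebra T t ht
    letI := prSecAlgebra X T hWV
    letI := fibreSecAlgebra X T t (fibreι X T t ⁻¹ᵁ W)
    fibreSectionsEquiv ht hWV hV hW (c ⊗ₜ r) =
      algebraMap (T.left.residueField t) _ c *
        (fibreι X T t).appLE W (fibreι X T t ⁻¹ᵁ W) le_rfl r := by
  letI := evalAlgebra T t ht
  letI := prSecAlgebra X T hWV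
  letI := fibreSecAlgebra X T t (fibreι X T t ⁻¹ᵁ W)
  letI := fibreιAlgebra X T t W
  letI := baseFibreAlgebra X T t hWV
  haveI := isScalarTower_prSec (t := t) hWV
  haveI := isScalarTower_eval ht hWV hV hW
  haveI : Algebra.IsPushout Γ(T.left, V) (T.left.residueField t) Γ((X ⊗ T).left, W)
      Γ((X ⊗ residuePt T t).left, fibreι X T t ⁻¹ᵁ W) := algebraIsPushout_fibre ht hWV hV hW
  exact Algebra.IsPushout.equiv_tmul Γ(T.left, V) (T.left.residueField t) Γ((X ⊗ T).left, W)
    Γ((X ⊗ residuePt T t).left, fibreι X T t ⁻¹ᵁ W) c r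

end AffineBaseChange

end Literature.AlgebraicGeometry.Motives

end
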